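import Summits.BirchSwinnertonDyer.BirchSwinnertonDyer.Theses.UniversalToricDescent
import Summits.BirchSwinnertonDyer.BirchSwinnertonDyer.Theorems.UniversalToricDescentTwinSplitIMCAtThreeOfThreeFrames
import Summits.BirchSwinnertonDyer.BirchSwinnertonDyer.Theorems.UniversalToricDescentSelfMuZeroAtThree
import Summits.BirchSwinnertonDyer.BirchSwinnertonDyer.Theorems.UniversalToricDescentRoadFFDescentOdd
import Summits.BirchSwinnertonDyer.BirchSwinnertonDyer.Theorems.UniversalToricDescentTwinTorsionRankOne
import Summits.BirchSwinnertonDyer.BirchSwinnertonDyer.Theorems.UniversalToricDescentTwinDecLocusCubeTest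
import HarnessLib

/-!
# SKELETON v6 PROPOSAL (line `threeframes`; width seat bsd-wall-utd-p2-w2 g2, 2026-08-28 ≈08:30Z, for the LEAD — NOT registered by
# this seat) for child crux `TwinSplitIMCAtThreeMult` (stmt-BirchSwinnertonDyer-20694, bucket B)

v6 = the LEAD's registered v5 (b49c3549e2c54b5e, `Lines/threeframes.lean`) with THREE stubs replaced by tree theorems landed
2026-08-28 07:20–08:00Z and the research content re-cut accordingly; the composition `twinSplit_instance_of_three_frames`
(p543791) and `TwinSplitIMCAtThreeMult_of` are UNCHANGED and still conclude the crux BY NAME.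

* `stub_prop323` (v5, PUB by name) — DELETED: it is the tree theorem `SkinnerUrban2014.prop323_XAc_equiv_XBigDecomp_holds`
  (Literature/…/BigRepModuleShapiroDualityProofs.lean, K2 item 20430).
* `stub_sigmaDataMult` (v5) ↦ **`stub_torsionMult`** [RESEARCH: `X^∅_ac(W′/K_∞; slot 𝔭′)` is `Λ`-torsion at 3 ∥ N′ — the
  Heegner side, not in print at p = 3 ∣ N′; PRINT on the (1,0)-locus `r_an(W′) = 1 ∧ L(W′^{(d_K)},1) ≠ 0` modulo
  GZK/hnf/PT1/PT2 by `twin_isTorsion_XAc_empty_of_rankOne_of_facts`, p613967] + the DERIVED `sigmaDataMult_of_stubs`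
  (= v5's `stub_sigmaDataMult` signature VERBATIM) by `twin_sigmaDataAt_of_isTorsion_empty'` (p613967 = LEAD's p611180 §3
  with its two published binders discharged: Shapiro `…_holds`, local Σ-display `…_proved` K2 item 20495).
* `stub_wanFrameMultNoDec` (v5, residual locus «split ∧ 3 ∣ v₃(Δ_min)») ↦ **`stub_wanFrameMultCube`** [RESEARCH] — the same
  conclusion on the EXACT no-(dec) locus: a Tate datum `D` at 3 with `D.q = u³`, `u ∈ ℚ₃` (⊊ v5's locus; = «3 ∣ v₃(Δ_min)
  ∧ q·3^{−v₃} ≡ ±1 (mod 9)», `twin_cube_locus_iff` p614724); ON it (dec) is FALSE (`twin_not_dec_of_cube`, p612881), so the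
  (dec)-fed member congruence `e_m` (p609362) provably does not reach it.
* `wanFrameMult_of_stubs` — now `rcases twin_dec_or_cube W′ hmult` (p612881): (dec) branch = member tower through the descent
  kernel (p609906) with Shapiro and the Σ-data as THEOREMS; cube branch = `stub_wanFrameMultCube`.

Stubs v6: `stub_howardFrameMult` (⊇; off the deciding chain after act D) · `stub_thmB` (PUB by name: Hsieh 2014 Thm B,
genuinely unformalised) · `stub_torsionMult` [R] · `stub_memberTowerMult` [R, K1–K3] · `stub_wanFrameMultCube` [R]. The
membertower line on ♭B 26062 is the same minus howard/thmB (3 research stubs, 0 PUB stubs). `lean check`: rc 0, sorries 5 =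
the stubs. PLANNER DATUM (pen option, not acted on): re-typing ♭B with the extra binder (dec) `∀ Q : W′(ℚ₃), 3•Q = 0 → Q = 0`
and strengthening the twin supply to deliver a (dec)-twin would move `stub_wanFrameMultCube` off the deciding chain (census
D7″ decides feasibility per class). BSD is not proved by any of this; every `sorry` below is a stub.

History: v1 (utd-p2 g2 / utd-idea g6, a2641b3bc9bf3dbf); v3 (lead g4, c7a28116); v4/v5 (lead g11, 245cc4bf/b49c3549:
member-tower reshape); v6 (this file, w2 g2: three stubs ↦ theorems).
-/

noncomputable section

open scoped Classical

set_option linter.dupNamespace false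
set_option autoImplicit false

namespace Summit.BirchSwinnertonDyer.BirchSwinnertonDyer.Cruxes.TwinSplitIMCAtThreeMult.ThreeFrames

open PowerSeries WeierstrassCurve NumberField IsDedekindDomain Field
  Literature.NumberTheory.EllipticCurves
  Literature.NumberTheory.EllipticCurves.ModularForms
  Literature.NumberTheory.EllipticCurves.Rank1Residual
  Literature.NumberTheory.EllipticCurves.BigGaloisRep
  Literature.NumberTheory.EllipticCurves.GreenbergSelmer
  Literature.NumberTheory.GaloisRepresentations
  Summit.BirchSwinnertonDyer.Rank1Residual.X11b
  Summit.BirchSwinnertonDyer.Rank1Residual.X11b.Halves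
  Summit.BirchSwinnertonDyer.BirchSwinnertonDyer.Theorems.SchneiderFree
  Summit.BirchSwinnertonDyer.BirchSwinnertonDyer.Theorems.UniversalToricDescentTwinSplit
  Summit.BirchSwinnertonDyer.BirchSwinnertonDyer.Theorems.UniversalToricDescentTwinTorsionRankOne
  Summit.BirchSwinnertonDyer.BirchSwinnertonDyer.Theorems.UniversalToricDescentTwinDecLocus

/-- STUB (Howard frame at a multiplicative-at-3 twin, 3 ∥ N′: ONE BDP branch inside the Selmer characteristic
ideal — research at p = 3 (Howard 2004: p ∤ N; Castella 2018 §4: p ≥ 5); free at unit pairs (p553371). OFF the deciding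
chain after act D (utd pen pss3x g3, 2026-08-28T05:16Z). UNCHANGED from v1/v3. -/
theorem stub_howardFrameMult :
    ∀ (W' : WeierstrassCurve ℚ) [W'.IsElliptic] [W'.IsGloballyMinimal] (N' : ℕ) [NeZero N']
      (K : Type) [Field K] [NumberField K] (Dt' : ModularParametrizationData W' N'),
      Mult W' 3 → W'.HasSurjectiveModNGaloisRep 3 → W'.conductorNorm ℤ = N' → IsImaginaryQuadratic K →
      SatisfiesHeegnerHypothesis N' K → Odd (NumberField.discr K) →
      ∀ (κ : ZpExtension K 3), κ.IsAnticyclotomic → ∀ (γ : absoluteGaloisGroup K) [Fact (κ.IsTopGenerator γ)]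
        (𝔭 : HeightOneSpectrum (𝓞 K)), ((3 : ℕ) : 𝓞 K) ∈ 𝔭.asIdeal →
        𝔭.asIdeal.ramificationIdx (𝓞 ℚ) = 1 → 𝔭.asIdeal.inertiaDeg (𝓞 ℚ) = 1 →
        ∀ (𝔭' : HeightOneSpectrum (𝓞 K)), ((3 : ℕ) : 𝓞 K) ∈ 𝔭'.asIdeal → 𝔭' ≠ 𝔭 →
        ∀ (ι' : PadicAlgCl 3 ≃+* ℂ), BranchInducesPrime 3 ι' 𝔭 →
        ∃ (ΩK : ℂ) (Ωp : ℂ_[3]) (L : UnrSeries 3), ΩK ≠ 0 ∧ Ωp ≠ 0 ∧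
          IsBDPLFunction ι' 𝔭 κ γ Dt'.f ΩK Ωp L ∧
          L ∈ (AcSelmer.XAc.charIdeal (W'.baseChange K) 3 κ 𝔭' ∅ γ).map (PowerSeries.map (toUnr 3)) := by
  sorry

/-- STUB (BY-NAME, refereed; closes only by formalisation): Hsieh 2014 Thm. B at every level — for a weight-2 newform
`f`, `p` odd split in `K`, classical Heegner hypothesis, absolutely irreducible residual representation over `K`: an
anticyclotomic `p`-adic `L`-function `Q ∈ 𝓞_{ℂ_p}⟦T⟧` with unramified `p`-adic period and a coefficient of norm one
(`μ = 0`). UNCHANGED from v3. [cite: Hsieh2014, Thm. B p. 712 (Doc. Math. 19)] -/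
theorem stub_thmB : Hsieh2014.thmB_exists_isHsiehLFunction_coeff_norm_eq_one_unrPeriod_anyLevel := by
  sorry

/-- STUB (RESEARCH — the torsion atom of v5's `stub_sigmaDataMult`): under the binders of the child crux (no frame prime
needed), the anticyclotomic BDP Selmer dual `X^∅_ac(W′/K_∞; slot 𝔭′)` of the 3-multiplicative twin `W′` is `Λ`-TORSION
[the Heegner side at `3 ∥ N′`: Bertolini 1995 / Howard 2004 / Cornut–Vatsal, NOT in print at a prime of multiplicative
reduction dividing the level with `p = 3`]. PRINT on the (1,0)-locus «`r_an(W′) = 1 ∧ L(W′^{(d_K)},1) ≠ 0`» modulo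
GZK/hnf/PT1/PT2 (`twin_isTorsion_XAc_empty_of_rankOne_of_facts`, p613967 — JSW17 Thm. 3.3.1 / Cas18 Thm. 2.3 control on the
constructed `X_ac` at every odd p); research off it (twins with `r_an(W′/K) ≠ 1` in that configuration).
[cite: JetchevSkinnerWan2017, Thm. 3.3.1 (arXiv:1512.06894 p. 11) (the printed (1,0)-case)] -/
theorem stub_torsionMult :
    ∀ (W' : WeierstrassCurve ℚ) [W'.IsElliptic] [W'.IsGloballyMinimal] (N' : ℕ) [NeZero N']
      (K : Type) [Field K] [NumberField K],
      Mult W' 3 → W'.HasSurjectiveModNGaloisRep 3 → W'.conductorNorm ℤ = N' → IsImaginaryQuadratic K →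
      SatisfiesHeegnerHypothesis N' K → Odd (NumberField.discr K) →
      ∀ (κ : ZpExtension K 3), κ.IsAnticyclotomic → ∀ (γ : absoluteGaloisGroup K) [Fact (κ.IsTopGenerator γ)]
        (𝔭' : HeightOneSpectrum (𝓞 K)), ((3 : ℕ) : 𝓞 K) ∈ 𝔭'.asIdeal →
        Module.IsTorsion (IwasawaAlgebra 3) (AcSelmer.XAc (W'.baseChange K) 3 κ 𝔭' ∅ γ) := by
  sorry

/-- DERIVED (no sorry of its own; = v5's registered `stub_sigmaDataMult` signature VERBATIM): the twin's Road-FF `Σ`-data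
at the X-slot — `Σ` finite, `X^Σ_ac` torsion, `P_Σ ≠ 0`, `Ch(X^∅)·(P_Σ) ⊆ Ch(X^Σ)` — from `stub_torsionMult` ALONE by
`twin_sigmaDataAt_of_isTorsion_empty'` (p613967 = the LEAD's p611180 §3 with its two published binders DISCHARGED:
Shapiro [SU14 3.2.3] `prop323_XAc_equiv_XBigDecomp_holds`, the local `Σ`-display [JSW17 pf. of 6.1.6]
`sigmaLocal_charIdeal_eulerFactor_mem_of_noTamagawaDefect_proved`; no Tamagawa defect under the all-split Heegner field).
[cite: JetchevSkinnerWan2017, §5.1 and proof of Thm. 6.1.6] [cite: SkinnerUrban2014, Prop. 3.2.3] [cite: Castella2018, Prop. 2.5] -/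
theorem sigmaDataMult_of_stubs :
    ∀ (W' : WeierstrassCurve ℚ) [W'.IsElliptic] [W'.IsGloballyMinimal] (N' : ℕ) [NeZero N']
      (K : Type) [Field K] [NumberField K],
      Mult W' 3 → W'.HasSurjectiveModNGaloisRep 3 → W'.conductorNorm ℤ = N' → IsImaginaryQuadratic K →
      SatisfiesHeegnerHypothesis N' K → Odd (NumberField.discr K) →
      ∀ (κ : ZpExtension K 3), κ.IsAnticyclotomic → ∀ (γ : absoluteGaloisGroup K) [Fact (κ.IsTopGenerator γ)]
        (𝔭' : HeightOneSpectrum (𝓞 K)), ((3 : ℕ) : 𝓞 K) ∈ 𝔭'.asIdeal →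
        P2.RoadFF.SigmaDataAt W' 3 κ 𝔭' γ (↑(W'.sigmaPlacesFinset 3 K) : Set (HeightOneSpectrum (𝓞 K)))
          (W'.sigmaEulerElement 3 K κ) := by
  intro W' _ _ N' _ K _ _ hmult hsurj hN' hK hH hodd κ hκ γ _ 𝔭' h𝔭'
  exact twin_sigmaDataAt_of_isTorsion_empty' W' N' K hmult hN' hK hH κ hκ γ 𝔭' h𝔭'
    (stub_torsionMult W' N' K hmult hsurj hN' hK hH hodd κ hκ γ 𝔭' h𝔭')

/-- STUB (THE HIDA MEMBER TOWER AT THE 3-MULTIPLICATIVE TWIN — RESEARCH, «beyond print»; the line's load-bearing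
statement after the reshape). Under the binders of the child crux: a frame `(Ω_K ≠ 0, Ω_p ∈ R₀ˣ, L)` of `f_{W′}` at
`(ι′, 𝔭)` and, for every `m ≥ 1`, a good-ordinary Hida member `g_m ∈ S_{k_m}(Γ₀(N′/3))`, `k_m > 2`, congruent to `f_{W′}`
mod `3^m` [K3: Ski16 §2.6 (2-6-1), printed `p ≥ 3`], whose `Σ`-imprimitive anticyclotomic Selmer dual over its own
coefficient ring satisfies, in every receptacle `S₀`: (2.5)_m «`X^Σ_ac(A_{g_m})` torsion → `Ch·S₀⟦T⟧ ⊆ (L_m)`» [K1: a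
weight-`k_m` ONE-SIDED Eisenstein inclusion for a GOOD-ORDINARY member under the ALL-SPLIT `K`, `m`-uniform — the engine
(Yan–Zhu 2026 / [SU14] `S⁻¹`-localisation) is printed in weight 2 at good ordinary `p` only] and (c)
`(L_m) ⊆ (L·P_Σ) + (3^m)` [K2: Castella 2020 Thm 2.11, standing `p > 2`]. Shape = the conclusion of the tree's OPEN
member package `Castella2018.erratum_members_exists_charIdeal_le_of_isTorsion_congruence_OPEN` with `p := 3`, `W := W′`,
`𝔭bar := 𝔭'`, erratum (i′)(ii)(iii)(iv) and `3 < p` dropped (vacuous / replaced under the all-split `K`).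
[cite: Skinner2016PacificMC, §2.6 (2-6-1), §3.1 (a)(b)(c) (p. 192)] [cite: Castella2020JIMJ, §2.5, Thm. 2.11]
[cite: YanZhu2026, Thm. 5.7(1), Cor. 4.6 (engine shape, weight 2)] -/
theorem stub_memberTowerMult :
    ∀ (W' : WeierstrassCurve ℚ) [W'.IsElliptic] [W'.IsGloballyMinimal] (N' : ℕ) [NeZero N']
      (K : Type) [Field K] [NumberField K] (Dt' : ModularParametrizationData W' N'),
      Mult W' 3 → W'.HasSurjectiveModNGaloisRep 3 → W'.conductorNorm ℤ = N' → IsImaginaryQuadratic K →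
      SatisfiesHeegnerHypothesis N' K → Odd (NumberField.discr K) →
      ∀ (κ : ZpExtension K 3), κ.IsAnticyclotomic → ∀ (γ : absoluteGaloisGroup K) [Fact (κ.IsTopGenerator γ)]
        (𝔭 : HeightOneSpectrum (𝓞 K)), ((3 : ℕ) : 𝓞 K) ∈ 𝔭.asIdeal →
        𝔭.asIdeal.ramificationIdx (𝓞 ℚ) = 1 → 𝔭.asIdeal.inertiaDeg (𝓞 ℚ) = 1 →
        ∀ (𝔭' : HeightOneSpectrum (𝓞 K)), ((3 : ℕ) : 𝓞 K) ∈ 𝔭'.asIdeal → 𝔭' ≠ 𝔭 →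
        ∀ (ι' : PadicAlgCl 3 ≃+* ℂ), BranchInducesPrime 3 ι' 𝔭 →
        ∃ (ΩK : ℂ) (Ωp : (unrIntegers 3)ˣ) (L : UnrSeries 3),
          ΩK ≠ 0 ∧ IsBDPLFunction ι' 𝔭 κ γ Dt'.f ΩK ((Ωp : unrIntegers 3) : ℂ_[3]) L ∧
          ∀ m : ℕ, 1 ≤ m →
            ∃ D : Skinner2016.HidaCongruentMember W' 3 m,
              ∀ [TopologicalSpace (PowerSeries (padicCoeffIntegers D.ι))]
                [ContinuousSMul (PowerSeries (padicCoeffIntegers D.ι))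
                  (BigRepModule (padicCoeffIntegers D.ι) 3 (Cofree D.Δ.ρ (padicCoeffField D.ι)))],
              ∀ (S₀ : Type) [CommRing S₀] (a : unrIntegers 3 →+* S₀) (b : padicCoeffIntegers D.ι →+* S₀)
                (j : ℤ_[3] →+* unrIntegers 3),
                (∀ x : ℤ_[3], ((j x : unrIntegers 3) : ℂ_[3]) = algebraMap ℚ_[3] ℂ_[3] (x : ℚ_[3])) →
                a.comp j = b.comp (algebraMap ℤ_[3] (padicCoeffIntegers D.ι)) →
                ∃ Lm : PowerSeries S₀,
                  (Module.IsTorsion (PowerSeries (padicCoeffIntegers D.ι))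
                      (XBig κ (D.Δ.cofreeRepOver K) 𝔭' (↑(W'.sigmaPlacesFinset 3 K))) →
                    (XBig.charIdeal κ (D.Δ.cofreeRepOver K) 𝔭' (↑(W'.sigmaPlacesFinset 3 K))).map
                        (PowerSeries.map b) ≤ Ideal.span {Lm}) ∧
                  Ideal.span {Lm} ≤
                    Ideal.span {PowerSeries.map a (L * PowerSeries.map j (W'.sigmaEulerElement 3 K κ))} ⊔
                      Ideal.span {((3 : ℕ) : PowerSeries S₀) ^ m} := by
  sorry

/-- STUB (THE CUBE LOCUS — research): the rational Wan frame (♭B's consequent VERBATIM) RESTRICTED to twins `W′` with a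
Tate parameter datum `D` at 3 (so `W′` is SPLIT multiplicative at 3) whose `q` is a CUBE in `ℚ₃` — the EXACT locus where the
descent kernel's local binder (dec) `W′(ℚ₃)[3] = 0` FAILS (`twin_not_dec_of_cube`, p612881: Tate uniformisation V.3.1/V.5.3,
all tree theorems), strictly inside v5's «split ∧ 3 ∣ v₃(Δ_min)» (`split_and_dvd_of_cube`) and decidable as
«3 ∣ v₃(Δ_min(W′)) ∧ q·3^{−v₃(q)} ≡ ±1 (mod 9)» (`twin_cube_locus_iff`, `three_mul_eq_valuation_of_eq`, p614724; census D7″).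
There the member congruence `e_m` (p609362) is unavailable as typed (the strict condition induced on `W′[3^m]` at `𝔭'` is
`W′(K_{𝔭'})[3^∞]/3^m ≠ 0`); a bounded-defect descent (error `#W′(ℚ₃)[3^∞]`, m-uniform, absorbed by `k`) is the natural
attack and is not in the tree. [cite: SilvermanATAEC1994, Thm. V.3.1 (d) and Thm. V.5.3 (the locus)]
[cite: Castella2018Erratum, Thm. A′ (2) and Remark (p. 2) («condition (b) of [SZ14]»)] -/
theorem stub_wanFrameMultCube :
    ∀ (W' : WeierstrassCurve ℚ) [W'.IsElliptic] [W'.IsGloballyMinimal] (N' : ℕ) [NeZero N']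
      (K : Type) [Field K] [NumberField K] (Dt' : ModularParametrizationData W' N'),
      Mult W' 3 → W'.HasSurjectiveModNGaloisRep 3 → W'.conductorNorm ℤ = N' → IsImaginaryQuadratic K →
      SatisfiesHeegnerHypothesis N' K → Odd (NumberField.discr K) →
      ∀ (κ : ZpExtension K 3), κ.IsAnticyclotomic → ∀ (γ : absoluteGaloisGroup K) [Fact (κ.IsTopGenerator γ)]
        (𝔭 : HeightOneSpectrum (𝓞 K)), ((3 : ℕ) : 𝓞 K) ∈ 𝔭.asIdeal →
        𝔭.asIdeal.ramificationIdx (𝓞 ℚ) = 1 → 𝔭.asIdeal.inertiaDeg (𝓞 ℚ) = 1 →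
        ∀ (𝔭' : HeightOneSpectrum (𝓞 K)), ((3 : ℕ) : 𝓞 K) ∈ 𝔭'.asIdeal → 𝔭' ≠ 𝔭 →
        ∀ (ι' : PadicAlgCl 3 ≃+* ℂ), BranchInducesPrime 3 ι' 𝔭 →
        ∀ (D : WeierstrassCurve.TateParameterData W' 3) (u : ℚ_[3]), u ^ 3 = D.q →
        ∃ (ΩK : ℂ) (Ωp : ℂ_[3]) (L : UnrSeries 3), ΩK ≠ 0 ∧ Ωp ≠ 0 ∧
          IsBDPLFunction ι' 𝔭 κ γ Dt'.f ΩK Ωp L ∧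
          ∃ k : ℕ, ∀ G ∈ (AcSelmer.XAc.charIdeal (W'.baseChange K) 3 κ 𝔭' ∅ γ).map
            (PowerSeries.map (toUnr 3)), PowerSeries.C (((3 : ℕ) : unrIntegers 3) ^ k) * G ∈ Ideal.span {L} := by
  sorry

/-- DERIVED (no sorry of its own; = v3's registered `stub_wanFrameMult` signature = ♭B VERBATIM): the rational Wan frame at
a multiplicative-at-3 twin, by the EXACT dichotomy `twin_dec_or_cube` (p612881): EITHER (dec) `W′(ℚ₃)[3] = 0` holds — then
the member tower (`stub_memberTowerMult`) runs through the landed descent kernel `twin_exists_wanFrame_of_sigmaData_of_memberTower`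
(p609906: `e_m` at p = 3, Fitting-level congruence frame, `Σ`-removal, two-prime cancellation, `k = 0`) with Shapiro a THEOREM
(`prop323_XAc_equiv_XBigDecomp_holds`) and the `Σ`-data DERIVED from `stub_torsionMult` (`sigmaDataMult_of_stubs`) — OR a
Tate datum with cube `q` exists, and `stub_wanFrameMultCube` answers.
[cite: Skinner2016PacificMC, §3.1 (p. 192) (mechanism)] [cite: Castella2018Erratum, proof of Thm. 1.1 (p. 4) (shape)]
[cite: SilvermanATAEC1994, Thm. V.3.1 (d) and Thm. V.5.3 (the dichotomy)] -/
theorem wanFrameMult_of_stubs :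
    ∀ (W' : WeierstrassCurve ℚ) [W'.IsElliptic] [W'.IsGloballyMinimal] (N' : ℕ) [NeZero N']
      (K : Type) [Field K] [NumberField K] (Dt' : ModularParametrizationData W' N'),
      Mult W' 3 → W'.HasSurjectiveModNGaloisRep 3 → W'.conductorNorm ℤ = N' → IsImaginaryQuadratic K →
      SatisfiesHeegnerHypothesis N' K → Odd (NumberField.discr K) →
      ∀ (κ : ZpExtension K 3), κ.IsAnticyclotomic → ∀ (γ : absoluteGaloisGroup K) [Fact (κ.IsTopGenerator γ)]
        (𝔭 : HeightOneSpectrum (𝓞 K)), ((3 : ℕ) : 𝓞 K) ∈ 𝔭.asIdeal →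
        𝔭.asIdeal.ramificationIdx (𝓞 ℚ) = 1 → 𝔭.asIdeal.inertiaDeg (𝓞 ℚ) = 1 →
        ∀ (𝔭' : HeightOneSpectrum (𝓞 K)), ((3 : ℕ) : 𝓞 K) ∈ 𝔭'.asIdeal → 𝔭' ≠ 𝔭 →
        ∀ (ι' : PadicAlgCl 3 ≃+* ℂ), BranchInducesPrime 3 ι' 𝔭 →
        ∃ (ΩK : ℂ) (Ωp : ℂ_[3]) (L : UnrSeries 3), ΩK ≠ 0 ∧ Ωp ≠ 0 ∧
          IsBDPLFunction ι' 𝔭 κ γ Dt'.f ΩK Ωp L ∧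
          ∃ k : ℕ, ∀ G ∈ (AcSelmer.XAc.charIdeal (W'.baseChange K) 3 κ 𝔭' ∅ γ).map
            (PowerSeries.map (toUnr 3)), PowerSeries.C (((3 : ℕ) : unrIntegers 3) ^ k) * G ∈ Ideal.span {L} := by
  intro W' _ _ N' _ K _ _ Dt' hmult hsurj hN' hK hH hodd κ hκ γ _ 𝔭 h𝔭 he hf 𝔭' h𝔭' hne ι' hι'
  rcases twin_dec_or_cube W' hmult with hdec | ⟨D, u, hu⟩
  · -- (dec) holds: run the member tower through the descent kernel (Shapiro and the Σ-data are theorems now)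
    obtain ⟨ΩK, Ωp, L, hΩ, hL, hmem⟩ :=
      stub_memberTowerMult W' N' K Dt' hmult hsurj hN' hK hH hodd κ hκ γ 𝔭 h𝔭 he hf 𝔭' h𝔭' hne ι' hι'
    exact twin_exists_wanFrame_of_sigmaData_of_memberTower SkinnerUrban2014.prop323_XAc_equiv_XBigDecomp_holds W' N' K
      hmult hsurj hN' hK hH κ hκ γ 𝔭 𝔭' h𝔭' ι' Dt'.f hdec
      (sigmaDataMult_of_stubs W' N' K hmult hsurj hN' hK hH hodd κ hκ γ 𝔭' h𝔭') hΩ hL hmem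
  · -- the cube locus: (dec) is false there (`twin_not_dec_of_cube`); the residual research stub answers
    exact stub_wanFrameMultCube W' N' K Dt' hmult hsurj hN' hK hH hodd κ hκ γ 𝔭 h𝔭 he hf 𝔭' h𝔭' hne ι' hι' D u hu

/-- DERIVED (no sorry of its own): every `R₀`-frame of `f_W` has a UNIT coefficient, at ANY reduction type at `3`, from
`stub_thmB` — utd-p1 g4's ♭-witness `self_exists_isBDPLFunctionInt_coeff_norm_eq_one` moved across periods and
receptacles by `exists_coeff_norm_eq_one_of_isBDPLFunctionInt_of_isBDPLFunction` (p538896), read through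
`unrIntegers.isUnit_iff_norm_eq_one`. UNCHANGED from v3. [cite: Hsieh2014, Thm. B p. 712 (Doc. Math. 19)] -/
theorem exists_isUnit_coeff_of_frame
    (W : WeierstrassCurve ℚ) [W.IsElliptic] (N : ℕ) [NeZero N]
    (K : Type) [Field K] [NumberField K] (Dt : ModularParametrizationData W N)
    (honto : W.HasSurjectiveModNGaloisRep 3) (hK : IsImaginaryQuadratic K)
    (hH : SatisfiesHeegnerHypothesis N K) (κ : ZpExtension K 3) (hκ : κ.IsAnticyclotomic)
    (γ : absoluteGaloisGroup K) [Fact (κ.IsTopGenerator γ)]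
    (𝔭 : HeightOneSpectrum (𝓞 K)) (h𝔭 : ((3 : ℕ) : 𝓞 K) ∈ 𝔭.asIdeal)
    (he : 𝔭.asIdeal.ramificationIdx (𝓞 ℚ) = 1) (hf : 𝔭.asIdeal.inertiaDeg (𝓞 ℚ) = 1)
    (ι' : PadicAlgCl 3 ≃+* ℂ) (hι' : BranchInducesPrime 3 ι' 𝔭)
    {ΩK : ℂ} {Ωp : ℂ_[3]} {L : UnrSeries 3} (hΩK : ΩK ≠ 0) (hΩp : Ωp ≠ 0)
    (hL : IsBDPLFunction ι' 𝔭 κ γ Dt.f ΩK Ωp L) :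
    ∃ i : ℕ, IsUnit (PowerSeries.coeff i L) := by
  obtain ⟨ΩK₁, Ωp₁, Q, hΩK₁, hΩp₁, hQ, hμQ⟩ :=
    Summit.BirchSwinnertonDyer.BirchSwinnertonDyer.Theorems.UniversalToricDescentSelfMuZero.self_exists_isBDPLFunctionInt_coeff_norm_eq_one stub_thmB W N K Dt honto hK hH
      κ hκ γ 𝔭 h𝔭 he hf ι' hι'
  have hΩp₁0 : Ωp₁ ≠ 0 := fun h ↦ by rw [h, norm_zero] at hΩp₁; exact zero_ne_one hΩp₁
  obtain ⟨i, hi⟩ :=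
    Summit.BirchSwinnertonDyer.BirchSwinnertonDyer.Theorems.UniversalToricDescentFlatMuTransfer.exists_coeff_norm_eq_one_of_isBDPLFunctionInt_of_isBDPLFunction hK hκ
      Fact.out hΩK₁ hΩK hΩp₁0 hΩp hQ hL hμQ
  exact ⟨i, (unrIntegers.isUnit_iff_norm_eq_one _).mpr hi⟩

/-- COMPOSITION (unchanged idea): the Howard frame stub, the DERIVED Wan frame and the by-name facts give the child
crux BY NAME (`twinSplit_instance_of_three_frames`, p543791; the `μ`-frame is the Howard frame, unit coefficient by
`exists_isUnit_coeff_of_frame`). -/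
theorem TwinSplitIMCAtThreeMult_of :
    Summit.BirchSwinnertonDyer.BirchSwinnertonDyer.Theses.UniversalToricDescent.TwinSplitIMCAtThreeMult := by
  intro W' _ _ N' _ K _ _ Dt' hmult hsurj hN' hK hH hodd κ hκ γ _ 𝔭 h𝔭 he hf 𝔭' h𝔭' hne ι' hι'
  have hH1 := stub_howardFrameMult W' N' K Dt' hmult hsurj hN' hK hH hodd κ hκ γ 𝔭 h𝔭 he hf 𝔭' h𝔭' hne ι' hι'
  have hMu : ∃ (ΩK : ℂ) (Ωp : ℂ_[3]) (L : UnrSeries 3), ΩK ≠ 0 ∧ Ωp ≠ 0 ∧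
      IsBDPLFunction ι' 𝔭 κ γ Dt'.f ΩK Ωp L ∧ ∃ i : ℕ, IsUnit (PowerSeries.coeff i L) := by
    obtain ⟨ΩK, Ωp, L, hΩK, hΩp, hL, -⟩ := hH1
    exact ⟨ΩK, Ωp, L, hΩK, hΩp, hL, exists_isUnit_coeff_of_frame W' N' K Dt' hsurj hK hH κ hκ γ 𝔭 h𝔭 he hf ι' hι'
      hΩK hΩp hL⟩
  exact twinSplit_instance_of_three_frames W' N' K Dt' κ γ 𝔭 𝔭' ι' hK hκ hH1
    (wanFrameMult_of_stubs W' N' K Dt' hmult hsurj hN' hK hH hodd κ hκ γ 𝔭 h𝔭 he hf 𝔭' h𝔭' hne ι' hι') hMu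

end Summit.BirchSwinnertonDyer.BirchSwinnertonDyer.Cruxes.TwinSplitIMCAtThreeMult.ThreeFrames

end
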